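import Literature.MathematicalPhysics.QuantumFieldTheory.Balaban1983to89.B3Eq324Parseval
import Literature.MathematicalPhysics.QuantumFieldTheory.Balaban1983to89.B3Eq329TorusWard
import HarnessLib

/-!
# B3 — T. Bałaban, *(Higgs)₂,₃ quantum fields in a finite volume. III. Renormalization*, CMP **88** (1983) 411–445
[Balaban1983Higgs3], p. 442 [PDF 32]: the square bracket of **(3.29)** VANISHES — the one-loop vector self-energy kernel
Π^{(ξ)}_{μμ′} of the free propagator C^ξ on ξℤ^d at zero momentum is 0 (the Ward–Takahashi identity (2.26) "with M² = 1")
— PROVED (file 2/2; file 1/2 is `B3Eq329TorusWard`, the zero-momentum Ward identity for the symbol σ_ξ on T^d)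

statement-level skeleton of published theorems with citation tags; proofs where landed; nothing here is a claim about
the Yang–Mills mass gap

PDF held: `paper:balaban1983-higgs-2-3-quantum-fields-finite-volume` (journal page = PDF page + 410).  Read: pp. 440–442
[PDF 30–32] on the ×2 renders `run/shared/lean/pub/pub-balaban/b2b-balaban-ref1/pages/1983-cmp88-higgs23-III/
1983-cmp88-higgs23-III-p030-x2.png` … `-p032-x2.png`, never the OCR layer alone.

CITATION HEADER (lean-in-tree rule).  Part of the lit-balaban TYPED SKELETON (HOME `run/shared/lean/pub/lit-balaban/`), PHASE 2,
proof seat p20 (generation 3).  WHAT IS REPRODUCED: row **B3.Eq3.25-3.32** of `HOME/lit-balaban-r15/ROWS-B3.md` (reader/typer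
and fold owner r15), the member listed there as *"NOT yet: … the WT-vanishing of (3.29)"*: the p. 442 sentence quoted below.
Companions: r15's `B3Sect3VectorSelfEnergy` ((3.26) `Pi2`/`bracket326_eq_Pi2`, (3.29) `expr329`, the infinite ξ-lattice `ZSite`,
`Cxi`, `pdiffZ`, `pdiffAdjZ`, (3.27) `lhs327`), p03 g2's `B3Eq324Parseval` (ξ^dC^ξ = 𝓕σ_ξ, `mFourierCoeff_symb`; (3.24)/(3.28)).

THE PRINTED TEXT (verbatim).  p. 441 [PDF 31]: *"Let us consider the corresponding term coming from Π^{(L^{−j₀},j₀)}_{μμ′}, and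
let us rescale the external legs A, A′ from the η-lattice to the ξ-lattice also. We get the expression (L^{j₁}η)^{−(d−2)/2}
(L^{j₀}η)^{d−(d−2)/2}[−Σ_{y,y′}ξ^{2d}Σ_{μ,μ′=1}^d g(y)A_μ(y) tr q²(C^ξ∂^{ξ*}_{μ′})(y−y′)(C^ξ∂^{ξ*}_μ)(y′−y)g′(y)A′_{μ′}(y)
+ Σ_{y,y′}ξ^{2d}Σ_{μ,μ′=1}^d g(y)A_μ(y) tr q²C^ξ(y−y′)(∂^ξ_{μ′}C^ξ∂^{ξ*}_μ)(y′−y)g′(y)A′_{μ′}(y) − Σ_yξ^dΣ_{μ=1}^d g(y)A_μ(y)g′(y)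
A′_{μ′}(y) tr q²C^ξ(0) − Σ_yξ^dΣ_{μ=1}^d g(y)A_μ(y)g′(y)A′_{μ′}(y) tr q²(C^ξ∂^{ξ*}_μ)(0)]. (3.29)"*; p. 442 [PDF 32]: *"Now if we
introduce the function λ(y′) = Σ_{μ′=1}^d g′(y)A′_{μ′}(y)(y′_{μ′} − y_{μ′}), then (∂^ξ_{μ′}λ)(y′) = g′(y)A′_{μ′}(y), and the
expression in the square bracket above has exactly the form appearing in the Ward-Takahashi identity (2.26) with M² = 1, hence
it is equal to 0."*

WHAT IS TYPED / PROVED, and how.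
* §1 `Pi2Z d ξ τ C μ μ′ y` — the kernel Π_{μμ′}(y) of the square bracket: r15's `Pi2` (p. 440: *"The expression in the square
  bracket on the right side of (3.26) has the form Σ_xη^dΣ_{μ,μ′}g(x)A_μ(x)Π_{μμ′}(x)g′(x)A′_{μ′}(x)"*, `bracket326_eq_Pi2`) written
  for ONE translation-invariant kernel C on the infinite ξ-lattice ξℤ^d = `ZSite d` (the carrier on which r15 typed C^ξ and
  (3.24)/(3.27)/(3.28); the x′-sum is a `tsum`; the nonlocal integrand is LITERALLY that of r15's `lhs327` without its factor
  (y′_ν − y_ν)); `bracket329Z` = the square bracket of (3.29) in this Π-form.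
* §5 **`Pi2Z_Cxi_eq_zero`**: Π^{(ξ)}_{μμ′}(y) = 0 for C = C^ξ = `Cxi d ξ`, every 0 < ξ, μ, μ′ ∈ {1,…,d}, y ∈ ℤ^d, τ = tr q² ∈ ℝ;
  hence **`bracket329Z_Cxi_eq_zero`**: the square bracket of (3.29) is 0 for all legs g, g′, A, A′ — the printed claim.
* THE ROUTE (momentum space; the paper's one-line appeal to (2.26) uses the NON-periodic test function λ(y′) = Σ c_{μ′}y′_{μ′} on
  ξℤ^d, i.e. the zero-momentum Ward identity, which is what file 1/2 proves directly on T^d):  §2 by `B3Eq324Parseval.mFourierCoeff_symb`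
  (ξ^dC^ξ(z) = 𝓕σ_ξ(z), σ_ξ(θ) = (ξ^{−2}μ(θ)+1)^{−1} on T^d, μ(θ) = Σ_i|e^{2πiθ_i} − 1|² = `latticeDispersion`) the four lattice
  functions in Π are Fourier coefficients: ξ^{d+1}∂^{ξ*}_μC^ξ = 𝓕[(e_μ − 1)σ_ξ], ξ^{d+1}∂^ξ_{μ′}C^ξ = 𝓕[(e_{−μ′} − 1)σ_ξ],
  ξ^{d+2}∂^ξ_{μ′}∂^{ξ*}_μC^ξ = 𝓕[(e_{−μ′} − 1)(e_μ − 1)σ_ξ] (`coeff_B`, `coeff_A`, `coeff_E`; e_m = Mathlib's `UnitAddTorus.mFourier`);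
  §3 Plancherel on T^d (the tree's `Torus.hasSum_conj_mul_mFourierCoeff`) and the evenness C^ξ(−z) = C^ξ(z), (∂^{ξ*}C)(−z) = (∂^ξC)(z)
  (r15) turn the nonlocal sum into ξ^{−d−2}Re∫_{T^d}(e_μ − 1)(e_{−μ′} − e_{μ′})σ_ξ² (`hasSum_nonlocal`, an absolutely convergent
  `HasSum`, so the printed Σ_{y′} — a `tsum` — is this number), and the local terms into C^ξ(0) + ξ(∂^{ξ*}_μC^ξ)(0) = C^ξ(−e_μ) =
  ξ^{−d}Re∫e_μσ_ξ (`local_eq`);  §4 for μ ≠ μ′ the torus integral is odd under the reflection θ_{μ′} ↦ −θ_{μ′} (file 1/2: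
  an integer lattice automorphism, `B3Eq329TorusWard.integral_reflMat`) hence 0 (`integral_offDiag`); for μ = μ′ it equals
  ξ²∫e_μσ_ξ (`integral_diag`) by the same reflection and the **zero-momentum Ward identity** ∫_{T^d}∂_μ[(e_μ − e_{−μ})σ_ξ] = 0
  (file 1/2 `B3Eq329TorusWard.integral_ward`: the tree's `Torus.integral_partialDeriv_eq_zero_holds` applied to the smooth
  function (e_μ − e_{−μ})σ_ξ, ∂_μe_{±μ} = ±2πie_{±μ}, ∂_μσ_ξ = 2πiξ^{−2}(e_μ − e_{−μ})σ_ξ²; in real form ξ²∫cos(2πθ_μ)σ_ξ =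
  2∫sin²(2πθ_μ)σ_ξ²);  §5 assembles.
* NOT CLAIMED, and a located caveat for the referees (GAPS.md G-B3-08): the vanishing is a statement on the INFINITE lattice ξℤ^d
  (r15's T5 reading of §6 of `B3Sect3VectorSelfEnergy`, where the paper writes momentum integrals).  On a finite torus T_ξ the
  same bracket (r15's `expr329`/`Pi2` with C = (−Δ^ξ+1)^{−1} of the torus) is NOT zero — the momentum integral of a derivative
  becomes a Riemann sum, e.g. d = 1, ξ = 1, n sites: Π = −2/5, −4/45, −8/2205, −16/4870845 for n = 2, 4, 8, 16 (exact rationals,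
  `HOME/lit-balaban-p20/pi329_torus_check.py`) — and the λ of p. 442 is not a function on the torus.  The WT identity (2.26)
  itself (row B3.Eq2.26-2.28, p39) is not used or restated here.
DEPENDENCES: `B3Eq329TorusWard` (this seat, file 1/2: `symb`, `U`, `Ub`, reflection and Ward lemmas), `B3Eq324Parseval` (p03 g2),
`B3Sect3VectorSelfEnergy` (r15), `Literature.Analysis.FunctionSpaces.{TorusVectorParseval, TorusFourierModes, FlatTorus}` (global-volume
torus Fourier analysis), Mathlib `Analysis.Fourier.AddCircleMulti`.  No new named fact (`def … : Prop`); definitions with bodies + theorems only; standard axioms.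
Unit `lit-balaban-p20` (literature-prover-lit-balaban-p20-g3-0), 2026-08-21; HOME/FILED.md records the proposal.
-/

open MeasureTheory Set Filter UnitAddTorus
open scoped BigOperators ComplexConjugate ContDiff

namespace Literature.MathematicalPhysics.QuantumFieldTheory.Balaban1983to89.B3Eq329WardVanishing

open B3Sect3VectorSelfEnergy B3Eq324Parseval B3Eq329TorusWard
open Literature.Analysis.FunctionSpaces Literature.Analysis.FunctionSpaces.LatticeFourier
open Literature.Analysis.FunctionSpaces.Torus

noncomputable section

variable {d : ℕ} {ξ : ℝ}

/-! ## 1. Π^{(ξ)}_{μμ′} on the infinite ξ-lattice -/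

/-- **Π^{(ξ)}_{μμ′}(y)** — the function Π^{(η,j₀)}_{μμ′} of p. 440 [PDF 30] (`B3Sect3VectorSelfEnergy.Pi2`: the kernel of the
square bracket of (3.26)) on the infinite ξ-lattice ξℤ^d with all three propagators equal to one translation-invariant kernel
`C` (for (3.29): C = C^ξ = `Cxi d ξ`), i.e. with G(y, y′) = C(y − y′) in the three kernel slots of `Pi2`:
Π_{μμ′}(y) = τΣ_{y′}ξ^d[−(C∂^{ξ*}_{μ′})(y−y′)(C∂^{ξ*}_μ)(y′−y) + C(y−y′)(∂^ξ_{μ′}C∂^{ξ*}_μ)(y′−y)] − δ_{μμ′}τC(0) − δ_{μμ′}τ·ξ(C∂^{ξ*}_μ)(0)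
(τ = tr q²; translation-invariant kernels (C∂^{ξ*}_μ)(u) = (∂^{ξ*}_μC)(u), (∂^ξ_{μ′}C∂^{ξ*}_μ)(u) = (∂^ξ_{μ′}∂^{ξ*}_μC)(u), exactly as in
r15's `lhs327`; the x′-sum is a `tsum`, T5 of `B3Sect3VectorSelfEnergy`).  The square bracket of (3.29) p. 441 is
Σ_y ξ^d Σ_{μμ′} g(y)A_μ(y) Π^{(ξ)}_{μμ′}(y) g′(y)A′_{μ′}(y) (`bracket326_eq_Pi2`). [cite: Balaban1983Higgs3, (3.29) p.441] -/
def Pi2Z (d : ℕ) (ξ τ : ℝ) (C : ZSite d → ℝ) (μ μ' : Fin d) (y : ZSite d) : ℝ :=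
  τ * (∑' y' : ZSite d, ξ ^ d *
      (-(pdiffAdjZ ξ⁻¹ μ' C (y - y') * pdiffAdjZ ξ⁻¹ μ C (y' - y)) +
        C (y - y') * pdiffZ ξ⁻¹ μ' (pdiffAdjZ ξ⁻¹ μ C) (y' - y)))
    - (if μ = μ' then τ * C 0 else 0) - (if μ = μ' then τ * (ξ * pdiffAdjZ ξ⁻¹ μ C 0) else 0)

/-- **The square bracket of (3.29)** p. 441 [PDF 31] on ξℤ^d, in the Π-form of p. 440 (`B3Sect3VectorSelfEnergy.bracket326_eq_Pi2`):
Σ_y ξ^d Σ_{μ,μ′} g(y)A_μ(y) Π^{(ξ)}_{μμ′}(y) g′(y)A′_{μ′}(y), external vector legs A_μ(y) = `A y μ`, localization functions g, g′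
(the y-sum a `tsum`; the printed prefactor (L^{j₁}η)^{−(d−2)/2}(L^{j₀}η)^{d−(d−2)/2}, r15's `prefactor329`, is left outside).
[cite: Balaban1983Higgs3, (3.29) p.441] -/
def bracket329Z (d : ℕ) (ξ τ : ℝ) (C : ZSite d → ℝ) (g g' : ZSite d → ℝ) (A A' : ZSite d → Fin d → ℝ) : ℝ :=
  ∑' y : ZSite d, ξ ^ d * ∑ μ : Fin d, ∑ μ' : Fin d, g y * A y μ * Pi2Z d ξ τ C μ μ' y * (g' y * A' y μ')

/-! ## 2. Fourier coefficients of σ_ξ and of its character multiples; Plancherel -/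

section Coefficients

/-- kernel: ξ^dC^ξ(z) = 𝓕σ_ξ(z) (p03: `B3Eq324Parseval.mFourierCoeff_symb`). [cite: Balaban1983Higgs3, (3.24) p.439] -/
private theorem coeff_symb (hξ : 0 < ξ) (z : ZSite d) :
    mFourierCoeff (symb (d := d) ξ) z = ((ξ ^ d * Cxi d ξ z : ℝ) : ℂ) :=
  mFourierCoeff_symb hξ z

/-- kernel: multiplication by a character shifts the Fourier coefficients, 𝓕(e_m · G)(k) = 𝓕G(k − m) (as in
`B3Eq324Parseval`). [folklore] -/
private theorem mFourierCoeff_mFourier_mul (G : UnitAddTorus (Fin d) → ℂ) (m k : Fin d → ℤ) :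
    mFourierCoeff (fun θ => mFourier m θ * G θ) k = mFourierCoeff G (k - m) := by
  unfold mFourierCoeff
  refine integral_congr_ae (ae_of_all _ fun θ => ?_)
  simp only [smul_eq_mul, ← mul_assoc, ← mFourier_add]
  rw [show -k + m = -(k - m) by abel]

/-- kernel: 𝓕[(e_m − 1)G](k) = g(k − m) − g(k) for a continuous G with real coefficients g. [folklore] -/
private theorem coeff_charSubOne_mul {G : UnitAddTorus (Fin d) → ℂ} (hG : Continuous G) {g : ZSite d → ℝ}
    (hg : ∀ k, mFourierCoeff G k = (g k : ℂ)) (m k : Fin d → ℤ) :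
    mFourierCoeff (fun θ => (mFourier m θ - 1) * G θ) k = ((g (k - m) - g k : ℝ) : ℂ) := by
  have h1 : Integrable (fun θ : UnitAddTorus (Fin d) => mFourier m θ * G θ) volume :=
    ((mFourier m).continuous.mul hG).integrable_unitAddTorus
  have hfun : (fun θ => (mFourier m θ - 1) * G θ) = (fun θ => mFourier m θ * G θ) - G := by
    funext θ; simp only [Pi.sub_apply]; ring
  rw [hfun, mFourierCoeff_sub h1 hG.integrable_unitAddTorus, mFourierCoeff_mFourier_mul, hg, hg]
  push_cast; ring

/-- 𝓕[(e_μ − 1)σ_ξ](z) = ξ^{d+1}(∂^{ξ*}_μC^ξ)(z). [cite: Balaban1983Higgs3, (3.29) p.441] -/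
theorem coeff_B (hξ : 0 < ξ) (μ : Fin d) (z : ZSite d) :
    mFourierCoeff (fun θ => (U μ θ - 1) * symb ξ θ) z = ((ξ ^ (d + 1) * pdiffAdjZ ξ⁻¹ μ (Cxi d ξ) z : ℝ) : ℂ) := by
  unfold U
  rw [coeff_charSubOne_mul (continuous_symb ξ) (coeff_symb hξ)]
  congr 1
  simp only [pdiffAdjZ, unitVec]
  rw [pow_succ]
  field_simp

/-- 𝓕[(e_{−μ′} − 1)σ_ξ](z) = ξ^{d+1}(∂^ξ_{μ′}C^ξ)(z). [cite: Balaban1983Higgs3, (3.29) p.441] -/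
theorem coeff_A (hξ : 0 < ξ) (μ' : Fin d) (z : ZSite d) :
    mFourierCoeff (fun θ => (Ub μ' θ - 1) * symb ξ θ) z = ((ξ ^ (d + 1) * pdiffZ ξ⁻¹ μ' (Cxi d ξ) z : ℝ) : ℂ) := by
  unfold Ub
  rw [coeff_charSubOne_mul (continuous_symb ξ) (coeff_symb hξ)]
  congr 1
  simp only [pdiffZ, unitVec, sub_neg_eq_add]
  rw [pow_succ]
  field_simp

/-- 𝓕[(e_{−μ′} − 1)(e_μ − 1)σ_ξ](z) = ξ^{d+2}(∂^ξ_{μ′}∂^{ξ*}_μC^ξ)(z). [cite: Balaban1983Higgs3, (3.29) p.441] -/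
theorem coeff_E (hξ : 0 < ξ) (μ μ' : Fin d) (z : ZSite d) :
    mFourierCoeff (fun θ => (Ub μ' θ - 1) * ((U μ θ - 1) * symb ξ θ)) z =
      ((ξ ^ (d + 2) * pdiffZ ξ⁻¹ μ' (pdiffAdjZ ξ⁻¹ μ (Cxi d ξ)) z : ℝ) : ℂ) := by
  have hc : Continuous fun θ : UnitAddTorus (Fin d) => (U μ θ - 1) * symb ξ θ := by fun_prop
  unfold Ub
  rw [coeff_charSubOne_mul hc (coeff_B hξ μ)]
  congr 1
  simp only [pdiffZ, unitVec, sub_neg_eq_add]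
  rw [pow_succ]
  field_simp
  ring

/-- kernel: continuous functions on the compact torus are in `L²`. [folklore] -/
private theorem memLp_two_of_continuous {f : UnitAddTorus (Fin d) → ℂ} (hf : Continuous f) :
    MemLp f 2 volume :=
  let g : C(UnitAddTorus (Fin d), ℂ) := ⟨f, hf⟩
  MemLp.of_bound hf.aestronglyMeasurable ‖g‖ (ae_of_all _ fun x => g.norm_coe_le_norm x)

/-- **Plancherel on T^d, polarised, for real coefficient sequences** (the tree's `Torus.hasSum_conj_mul_mFourierCoeff`):
if 𝓕Φ = u, 𝓕F = v are real then Σ_z u(z)v(z) = Re ∫ conj Φ · F (as a `HasSum`). [folklore] -/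
private theorem hasSum_mul_of_coeff {Φ F : UnitAddTorus (Fin d) → ℂ} (hΦ : Continuous Φ) (hF : Continuous F)
    {u v : ZSite d → ℝ} (hu : ∀ z, mFourierCoeff Φ z = (u z : ℂ)) (hv : ∀ z, mFourierCoeff F z = (v z : ℂ)) :
    HasSum (fun z => u z * v z) (∫ θ, conj (Φ θ) * F θ).re := by
  have h := hasSum_conj_mul_mFourierCoeff (memLp_two_of_continuous hΦ) (memLp_two_of_continuous hF)
  simp only [hu, hv, Complex.conj_ofReal, ← Complex.ofReal_mul] at h
  have h2 := Complex.reCLM.hasSum h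
  simpa only [Complex.reCLM_apply, Complex.ofReal_re] using h2

end Coefficients

/-! ## 3. Π^{(ξ)}_{μμ′} as a torus integral -/

section Assembly

/-- kernel: the nonlocal part of Π^{(ξ)}_{μμ′}(y), reindexed by z = y′ − y and symmetrised with C^ξ(−z) = C^ξ(z),
(∂^{ξ*}C^ξ)(−z) = (∂^ξC^ξ)(z). [cite: Balaban1983Higgs3, (3.29) p.441] -/
theorem tsum_nonlocal_reindex (ξ : ℝ) (μ μ' : Fin d) (y : ZSite d) :
    (∑' y' : ZSite d, ξ ^ d *
      (-(pdiffAdjZ ξ⁻¹ μ' (Cxi d ξ) (y - y') * pdiffAdjZ ξ⁻¹ μ (Cxi d ξ) (y' - y)) +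
        Cxi d ξ (y - y') * pdiffZ ξ⁻¹ μ' (pdiffAdjZ ξ⁻¹ μ (Cxi d ξ)) (y' - y))) =
    ∑' z : ZSite d, ξ ^ d *
      (-(pdiffZ ξ⁻¹ μ' (Cxi d ξ) z * pdiffAdjZ ξ⁻¹ μ (Cxi d ξ) z) +
        Cxi d ξ z * pdiffZ ξ⁻¹ μ' (pdiffAdjZ ξ⁻¹ μ (Cxi d ξ)) z) := by
  rw [← (Equiv.addRight y).tsum_eq]
  refine tsum_congr fun z => ?_
  simp only [Equiv.coe_addRight, show y - (z + y) = -z by abel, show z + y - y = z by abel,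
    pdiffAdjZ_neg_of_even _ _ _ (Cxi_neg ξ), Cxi_neg]

/-- kernel: the nonlocal sum by Plancherel: Σ_z ξ^d[−(∂^ξ_{μ′}C)(∂^{ξ*}_μC) + C·∂^ξ_{μ′}∂^{ξ*}_μC](z)
= ξ^{−d−2} Re ∫_{T^d} (e_μ − 1)(e_{−μ′} − e_{μ′}) σ_ξ² (a `HasSum`). [cite: Balaban1983Higgs3, (3.29) p.441] -/
theorem hasSum_nonlocal (hξ : 0 < ξ) (μ μ' : Fin d) :
    HasSum (fun z : ZSite d => ξ ^ d *
      (-(pdiffZ ξ⁻¹ μ' (Cxi d ξ) z * pdiffAdjZ ξ⁻¹ μ (Cxi d ξ) z) +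
        Cxi d ξ z * pdiffZ ξ⁻¹ μ' (pdiffAdjZ ξ⁻¹ μ (Cxi d ξ)) z))
      ((ξ ^ (d + 2))⁻¹ *
        (∫ θ : UnitAddTorus (Fin d), (U μ θ - 1) * (Ub μ' θ - U μ' θ) * symb ξ θ ^ 2).re) := by
  have cA : Continuous fun θ : UnitAddTorus (Fin d) => (Ub μ' θ - 1) * symb ξ θ := by fun_prop
  have cB : Continuous fun θ : UnitAddTorus (Fin d) => (U μ θ - 1) * symb ξ θ := by fun_prop
  have cE : Continuous fun θ : UnitAddTorus (Fin d) => (Ub μ' θ - 1) * ((U μ θ - 1) * symb ξ θ) := by fun_prop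
  -- the two Plancherel identities
  have hAB := hasSum_mul_of_coeff cA cB (coeff_A hξ μ') (coeff_B hξ μ)
  have hCE := hasSum_mul_of_coeff (continuous_symb ξ) cE (coeff_symb hξ) (coeff_E hξ μ μ')
  have h := (hAB.neg.add hCE).mul_left ((ξ ^ (d + 2))⁻¹)
  have hξ2 : ξ ^ (d + 2) ≠ 0 := pow_ne_zero _ hξ.ne'
  have hfun : (fun z : ZSite d => (ξ ^ (d + 2))⁻¹ *
      (-(ξ ^ (d + 1) * pdiffZ ξ⁻¹ μ' (Cxi d ξ) z * (ξ ^ (d + 1) * pdiffAdjZ ξ⁻¹ μ (Cxi d ξ) z)) +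
        ξ ^ d * Cxi d ξ z * (ξ ^ (d + 2) * pdiffZ ξ⁻¹ μ' (pdiffAdjZ ξ⁻¹ μ (Cxi d ξ)) z))) =
      fun z => ξ ^ d * (-(pdiffZ ξ⁻¹ μ' (Cxi d ξ) z * pdiffAdjZ ξ⁻¹ μ (Cxi d ξ) z) +
        Cxi d ξ z * pdiffZ ξ⁻¹ μ' (pdiffAdjZ ξ⁻¹ μ (Cxi d ξ)) z) := by
    funext z
    field_simp
    ring
  rw [hfun] at h
  -- the integrands: ∫ conj(σ)E − ∫ conj(A)B = ∫ (e_μ − 1)(e_{−μ′} − e_{μ′})σ²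
  have hi1 : Integrable (fun θ : UnitAddTorus (Fin d) => conj ((Ub μ' θ - 1) * symb ξ θ) *
      ((U μ θ - 1) * symb ξ θ)) volume := (cA.star.mul cB).integrable_unitAddTorus
  have hi2 : Integrable (fun θ : UnitAddTorus (Fin d) => conj (symb ξ θ) *
      ((Ub μ' θ - 1) * ((U μ θ - 1) * symb ξ θ))) volume := ((continuous_symb ξ).star.mul cE).integrable_unitAddTorus
  have hJ : (∫ θ : UnitAddTorus (Fin d), conj (symb ξ θ) * ((Ub μ' θ - 1) * ((U μ θ - 1) * symb ξ θ))) -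
      (∫ θ : UnitAddTorus (Fin d), conj ((Ub μ' θ - 1) * symb ξ θ) * ((U μ θ - 1) * symb ξ θ)) =
      ∫ θ : UnitAddTorus (Fin d), (U μ θ - 1) * (Ub μ' θ - U μ' θ) * symb ξ θ ^ 2 := by
    rw [← integral_sub hi2 hi1]
    refine integral_congr_ae (ae_of_all _ fun θ => ?_)
    simp only [map_mul, map_sub, map_one, (conj_U μ' θ).2, conj_symb]
    ring
  have hval : -(∫ θ : UnitAddTorus (Fin d), conj ((Ub μ' θ - 1) * symb ξ θ) * ((U μ θ - 1) * symb ξ θ)).re +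
      (∫ θ : UnitAddTorus (Fin d), conj (symb ξ θ) * ((Ub μ' θ - 1) * ((U μ θ - 1) * symb ξ θ))).re =
      (∫ θ : UnitAddTorus (Fin d), (U μ θ - 1) * (Ub μ' θ - U μ' θ) * symb ξ θ ^ 2).re := by
    rw [← hJ, Complex.sub_re]
    ring
  rw [hval] at h
  exact h

/-- kernel: the local part: C^ξ(0) + ξ(∂^{ξ*}_μC^ξ)(0) = C^ξ(−e_μ) = ξ^{−d} Re ∫ e_μ σ_ξ. [cite: Balaban1983Higgs3, (3.29) p.441] -/
theorem local_eq (hξ : 0 < ξ) (μ : Fin d) :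
    Cxi d ξ 0 + ξ * pdiffAdjZ ξ⁻¹ μ (Cxi d ξ) 0 =
      (ξ ^ d)⁻¹ * (∫ θ : UnitAddTorus (Fin d), U μ θ * symb ξ θ).re := by
  have h1 : Cxi d ξ 0 + ξ * pdiffAdjZ ξ⁻¹ μ (Cxi d ξ) 0 = Cxi d ξ (-unitVec μ) := by
    simp only [pdiffAdjZ, zero_sub]
    field_simp
    ring
  have h2 : ((ξ ^ d * Cxi d ξ (-unitVec μ) : ℝ) : ℂ) = ∫ θ : UnitAddTorus (Fin d), U μ θ * symb ξ θ := by
    rw [← coeff_symb hξ, mFourierCoeff_eq_integral_volume, neg_neg]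
    rfl
  have h3 : ξ ^ d * Cxi d ξ (-unitVec μ) = (∫ θ : UnitAddTorus (Fin d), U μ θ * symb ξ θ).re := by
    rw [← h2, Complex.ofReal_re]
  have hξd : ξ ^ d ≠ 0 := pow_ne_zero _ hξ.ne'
  rw [h1, ← h3]
  field_simp

end Assembly

/-! ## 4. The two torus integrals: μ ≠ μ′ by reflection, μ = μ′ by the Ward identity -/

section TorusIntegrals

/-- kernel (μ ≠ μ′): ∫ (e_μ − 1)(e_{−μ′} − e_{μ′})σ_ξ² = 0 — the integrand is odd under θ_{μ′} ↦ −θ_{μ′}.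
[cite: Balaban1983Higgs3, (3.29) p.442] -/
theorem integral_offDiag (ξ : ℝ) {μ μ' : Fin d} (hne : μ ≠ μ') :
    ∫ θ : UnitAddTorus (Fin d), (U μ θ - 1) * (Ub μ' θ - U μ' θ) * symb ξ θ ^ 2 = 0 := by
  have h := integral_reflMat μ' (fun θ => (U μ θ - 1) * (Ub μ' θ - U μ' θ) * symb ξ θ ^ 2)
  have hodd : ∀ θ : UnitAddTorus (Fin d),
      (U μ (mulVecT (reflMat μ') θ) - 1) * (Ub μ' (mulVecT (reflMat μ') θ) - U μ' (mulVecT (reflMat μ') θ)) *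
        symb ξ (mulVecT (reflMat μ') θ) ^ 2 = -((U μ θ - 1) * (Ub μ' θ - U μ' θ) * symb ξ θ ^ 2) := by
    intro θ
    rw [(U_reflMat_ne hne θ).1, (U_reflMat_self μ' θ).1, (U_reflMat_self μ' θ).2, symb_reflMat]
    ring
  simp_rw [hodd, integral_neg] at h
  linear_combination (-1 / 2 : ℂ) * h

/-- kernel (μ = μ′): ∫ (e_μ − 1)(e_{−μ} − e_μ)σ_ξ² = ξ²∫ e_μ σ_ξ — reflection symmetry θ_μ ↦ −θ_μ plus the integrated Ward
identity `integral_ward`. [cite: Balaban1983Higgs3, (3.29) p.442] -/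
theorem integral_diag (ξ : ℝ) (hξ : ξ ≠ 0) (μ : Fin d) :
    ∫ θ : UnitAddTorus (Fin d), (U μ θ - 1) * (Ub μ θ - U μ θ) * symb ξ θ ^ 2 =
      (ξ : ℂ) ^ 2 * ∫ θ : UnitAddTorus (Fin d), U μ θ * symb ξ θ := by
  have cu : Continuous (U (d := d) μ) := continuous_U μ
  have cub : Continuous (Ub (d := d) μ) := continuous_Ub μ
  have cs : Continuous (symb (d := d) ξ) := continuous_symb ξ
  -- reflection facts
  have ruR : ∀ θ : UnitAddTorus (Fin d), U μ (mulVecT (reflMat μ) θ) = Ub μ θ := fun θ => (U_reflMat_self μ θ).1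
  have rubR : ∀ θ : UnitAddTorus (Fin d), Ub μ (mulVecT (reflMat μ) θ) = U μ θ := fun θ => (U_reflMat_self μ θ).2
  have rsR : ∀ θ : UnitAddTorus (Fin d), symb ξ (mulVecT (reflMat μ) θ) = symb ξ θ := fun θ => symb_reflMat ξ μ θ
  -- step 1: J = ∫ (ē − 1)(e − ē)σ² by reflection
  have step1 : (∫ θ : UnitAddTorus (Fin d), (U μ θ - 1) * (Ub μ θ - U μ θ) * symb ξ θ ^ 2) =
      ∫ θ : UnitAddTorus (Fin d), (Ub μ θ - 1) * (U μ θ - Ub μ θ) * symb ξ θ ^ 2 := by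
    rw [← integral_reflMat μ (fun θ => (Ub μ θ - 1) * (U μ θ - Ub μ θ) * symb ξ θ ^ 2)]
    simp_rw [ruR, rubR, rsR]
  -- step 2: 2J = −∫ (e − ē)²σ²
  have i1 : Integrable (fun θ : UnitAddTorus (Fin d) => (U μ θ - 1) * (Ub μ θ - U μ θ) * symb ξ θ ^ 2) volume :=
    (((cu.sub continuous_const).mul (cub.sub cu)).mul (cs.pow 2)).integrable_unitAddTorus
  have i2 : Integrable (fun θ : UnitAddTorus (Fin d) => (Ub μ θ - 1) * (U μ θ - Ub μ θ) * symb ξ θ ^ 2) volume :=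
    (((cub.sub continuous_const).mul (cu.sub cub)).mul (cs.pow 2)).integrable_unitAddTorus
  have step2 : (∫ θ : UnitAddTorus (Fin d), (U μ θ - 1) * (Ub μ θ - U μ θ) * symb ξ θ ^ 2) +
      (∫ θ : UnitAddTorus (Fin d), (U μ θ - 1) * (Ub μ θ - U μ θ) * symb ξ θ ^ 2) =
      -∫ θ : UnitAddTorus (Fin d), (U μ θ - Ub μ θ) ^ 2 * symb ξ θ ^ 2 := by
    nth_rw 2 [step1]
    rw [← integral_add i1 i2, ← integral_neg]
    refine integral_congr_ae (ae_of_all _ fun θ => ?_)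
    ring
  -- step 3: ∫ (e + ē)σ = 2 ∫ e σ by reflection
  have i5 : Integrable (fun θ : UnitAddTorus (Fin d) => U μ θ * symb ξ θ) volume := (cu.mul cs).integrable_unitAddTorus
  have i6 : Integrable (fun θ : UnitAddTorus (Fin d) => Ub μ θ * symb ξ θ) volume := (cub.mul cs).integrable_unitAddTorus
  have step3 : (∫ θ : UnitAddTorus (Fin d), (U μ θ + Ub μ θ) * symb ξ θ) =
      2 * ∫ θ : UnitAddTorus (Fin d), U μ θ * symb ξ θ := by
    have hr : (∫ θ : UnitAddTorus (Fin d), Ub μ θ * symb ξ θ) = ∫ θ : UnitAddTorus (Fin d), U μ θ * symb ξ θ := by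
      rw [← integral_reflMat μ (fun θ => Ub μ θ * symb ξ θ)]
      simp_rw [rubR, rsR]
    simp_rw [add_mul]
    rw [integral_add i5 i6, hr]
    ring
  -- conclusion from the Ward identity
  have hξC : (ξ : ℂ) ≠ 0 := Complex.ofReal_ne_zero.2 hξ
  have hW := integral_ward ξ μ
  rw [step3] at hW
  field_simp at hW
  have e1 : (∫ θ : UnitAddTorus (Fin d), (U μ θ - 1) * (Ub μ θ - U μ θ) * symb ξ θ ^ 2) +
      (∫ θ : UnitAddTorus (Fin d), (U μ θ - 1) * (Ub μ θ - U μ θ) * symb ξ θ ^ 2) =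
      (ξ : ℂ) ^ 2 * (2 * ∫ θ : UnitAddTorus (Fin d), U μ θ * symb ξ θ) := by
    rw [step2]
    linear_combination -hW
  linear_combination e1 / 2

end TorusIntegrals

/-! ## 5. The theorem: the bracket of (3.29) vanishes on ξℤ^d -/

/-- **p. 442 [PDF 32] of [Balaban1983Higgs3]** (row B3.Eq3.25-3.32), verbatim: *"Now if we introduce the function λ(y′) =
Σ_{μ′=1}^d g′(y)A′_{μ′}(y)(y′_{μ′} − y_{μ′}), then (∂^ξ_{μ′}λ)(y′) = g′(y)A′_{μ′}(y), and the expression in the square bracket above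
[(3.29)] has exactly the form appearing in the Ward-Takahashi identity (2.26) with M² = 1, hence it is equal to 0."* — PROVED on
the infinite ξ-lattice ξℤ^d for the free propagator C^ξ = (−Δ^ξ + 1)^{−1} (`Cxi`): the kernel Π^{(ξ)}_{μμ′}(y) of that square bracket
(`Pi2Z`, = r15's `Pi2` with all propagators C^ξ) VANISHES for every 0 < ξ, μ, μ′, y, τ.  Route (momentum space, in place of the
printed appeal to (2.26) with the non-periodic λ): by `B3Eq324Parseval.mFourierCoeff_symb` (ξ^dC^ξ = 𝓕σ_ξ) and Plancherel on T^d,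
Π^{(ξ)}_{μμ′} = τξ^{−d−2}[Re∫_{T^d}(e_μ − 1)(e_{−μ′} − e_{μ′})σ_ξ² − δ_{μμ′}ξ² Re∫e_μσ_ξ]; for μ ≠ μ′ the integral is odd under
θ_{μ′} ↦ −θ_{μ′} (`integral_offDiag`), for μ = μ′ it equals ξ²∫e_μσ_ξ by the zero-momentum Ward identity ∫∂_μ[(e_μ − e_{−μ})σ_ξ] = 0
(`integral_ward`, `integral_diag`). [cite: Balaban1983Higgs3, (3.29) p.442] -/
theorem Pi2Z_Cxi_eq_zero (hξ : 0 < ξ) (τ : ℝ) (μ μ' : Fin d) (y : ZSite d) :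
    Pi2Z d ξ τ (Cxi d ξ) μ μ' y = 0 := by
  unfold Pi2Z
  rw [tsum_nonlocal_reindex, (hasSum_nonlocal hξ μ μ').tsum_eq]
  by_cases h : μ = μ'
  · subst h
    rw [if_pos rfl, if_pos rfl, integral_diag ξ hξ.ne' μ]
    have hl := local_eq hξ μ
    have hξd : ξ ^ d ≠ 0 := pow_ne_zero _ hξ.ne'
    have hξ2 : ξ ^ 2 ≠ 0 := pow_ne_zero _ hξ.ne'
    have hre : ((ξ : ℂ) ^ 2 * ∫ θ : UnitAddTorus (Fin d), U μ θ * symb ξ θ).re =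
        ξ ^ 2 * (∫ θ : UnitAddTorus (Fin d), U μ θ * symb ξ θ).re := by
      rw [← Complex.ofReal_pow, Complex.re_ofReal_mul]
    have hpow : (ξ ^ (d + 2))⁻¹ * (ξ ^ 2 * (∫ θ : UnitAddTorus (Fin d), U μ θ * symb ξ θ).re) =
        (ξ ^ d)⁻¹ * (∫ θ : UnitAddTorus (Fin d), U μ θ * symb ξ θ).re := by
      rw [pow_add]
      field_simp
    rw [hre, hpow, ← hl]
    ring
  · rw [if_neg h, if_neg h, integral_offDiag ξ h, Complex.zero_re, mul_zero, mul_zero, sub_zero, sub_zero]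

/-- **p. 442 [PDF 32]**, verbatim: *"… the expression in the square bracket above [(3.29)] has exactly the form appearing in the
Ward-Takahashi identity (2.26) with M² = 1, hence it is equal to 0."* — PROVED on ξℤ^d: the square bracket of (3.29)
(`bracket329Z`, Π-form) vanishes for C^ξ and all legs g, g′, A, A′ (0 < ξ), since its kernel Π^{(ξ)}_{μμ′} vanishes identically
(`Pi2Z_Cxi_eq_zero`). [cite: Balaban1983Higgs3, (3.29) p.442] -/
theorem bracket329Z_Cxi_eq_zero (hξ : 0 < ξ) (τ : ℝ) (g g' : ZSite d → ℝ) (A A' : ZSite d → Fin d → ℝ) :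
    bracket329Z d ξ τ (Cxi d ξ) g g' A A' = 0 := by
  simp only [bracket329Z, Pi2Z_Cxi_eq_zero hξ, mul_zero, zero_mul, Finset.sum_const_zero, tsum_zero]

end

end Literature.MathematicalPhysics.QuantumFieldTheory.Balaban1983to89.B3Eq329WardVanishing
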